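import Summits.QuantumFields.YangMills.Theorems.BalabanLadderIRColdPurityBridge
import Summits.QuantumFields.YangMills.Theorems.BalabanLadderIRColdDoublingRecursionSC
import Literature.MathematicalPhysics.QuantumFieldTheory.WilsonFinTorusPartitionComplex
import HarnessLib

/-!
# Crux `BalabanLadder.IR` (stmt-QuantumFields-19354) — LINE `harmonic-purity-channel` (ideator ym-ir-idea-16 g0, lens «anomaly» +
«assume no gap» structure)

SKELETON (2 ≤ stubs ≤ 7; `IR_of` concludes the crux BY NAME, kernel-checked, sorries ONLY inside `stub_*`).

THE LEVER (new on this crux and on this summit's 15 lines / 75 cards: searched, see the card): transport the COLD PURITY of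
Wilson's theory from strong to weak coupling by HARMONIC MEASURE.  For a holomorphic one-parameter family `z ↦ w_z` of complex
plaquette weights `G → ℂ` on a channel `D ⊂ ℂ` (open, connected) joining a near-Haar ANCHOR disc (`‖w_z − 1‖∞ ≤ ε₀`: complex
strong coupling, Kotecký–Preiss) to the TARGET `w_{z_T} = exp(−β (N − Re tr ρ))` (Wilson, representation `r`, weak coupling `β`),
the complex purity ratio `h_L(z) = Z_{L³×2⌊L/4⌋}[w_z] / Z_{L³×⌊L/4⌋}[w_z]²` is holomorphic wherever the cold partition function
has no (Fisher) zero, and `log ‖1 − h_L‖` is SUBHARMONIC.  Bulk free energies cancel EXACTLY in the ratio (`|Λ_{2t}| = 2|Λ_t|`),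
so no continued bulk pressure is needed; on the anchor disc `‖1 − h_L‖ ≤ C L⁴ e^{−cL}` (time-wrapping clusters only); if the
channel is zero-free with `‖h_L‖ ≤ M` for all large `L` (the LOAD `PurityChannel`), the two-constants theorem (Nevanlinna;
here as Hadamard-three-circles propagation of smallness, `TwoConstants`) gives at the real target
`δᶜ_β(L) = 1 − h_L(z_T) ≤ (C L⁴ e^{−cL})^{ω} (1+M)^{1−ω} → 0` with `ω = ω(D, anchor, z_T) ∈ (0,1]` INDEPENDENT of `L`:
one pure cold torus per weak coupling, i.e. obligation **E** `ColdPurityBridge.ColdExitSC` — even with a rate.  ANY positive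
harmonic measure suffices because the scale transfer **R** `ColdDoublingRecursionSC` is PROVED in tree for every compact group
(`AspectBootstrap.R_holds`, C = 2·432²·e^{432}) and the seam `ColdPurityBridge.IR_of_bridge : R → E → AFToColdPressure → IRnsc → IR`
is PROVED: so the line is  `PurityChannel ∧ ComplexAnchor ∧ TwoConstants ⇒ E`,  `E ∧ R(proved) ∧ X ∧ N ⇒ IR`.

WHY A PATH THROUGH GENERAL WEIGHTS (not the complex `β`-plane of the Wilson action): on-axis bulk first-order walls exist for
some `(G, r)` (tree: `enterShlosman_narrowWell_firstOrderTransition`, `stub_wilsonAxisAnalyticAllFalse` of crux `AnalyticDetour`;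
print: G₂, SU(N ≥ 5) fundamental) and a Fisher-zero wall crossing the real axis separates the strong-coupling anchor from the
target in the plane; in the space of class-function actions the wall ends on an endpoint manifold of real codimension 2 and a
real detour (Bhanot–Creutz plane) thinly complexified goes around it.  NO reflection positivity is used off the two endpoints —
the detour may cross `β_A < 0` — so `Literature.Barriers.QuantumFields.ImprovedActionPositivityViolation` (which stops route
`GronwallGap`'s `AnalyticDetour`) does not bite.

STUBS: `stub_purityChannel` (LOAD, XL: the infrared wall in complex-analytic currency — «no wall of cold-torus Fisher zeros /
purity blow-ups separates strong from weak coupling»; false exactly where E is false: `U(1)₄` zeros pinch the axis at β ≈ 1.01,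
Du 2011 p. 11; `π₁ ≠ 1` light flux), `stub_complexAnchor` (L, located supplier: KP polymer expansion for a near-Haar complex
plaquette activity, time-wrapping clusters; the complex-Wilson instance is in tree: `PeriodicBoxFreeEnergyLimits.exists_tube_rate`,
the real instance is `ColdPurityBridge.coldDefect_le_of_strongCoupling`), `stub_twoConstants` (M, classical: chain of Hadamard
three-circles = Mathlib `Complex.HadamardThreeLines` after `exp`), `stub_exit_of_channel` (M/L seam: holomorphy of parametric
Haar integrals, `∏ exp = exp ∑` identification with `wilsonFinTorusPartition`, bookkeeping), `stub_afPin` (X, shared XL with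
lines af-pincer / doubling-bridge), `stub_residual` (N, shared residual `IRnsc`).

HONEST FRAMING.  The Yang–Mills mass gap (Clay) is NOT proved by anything here; R4 (`BalabanUVStability4`) closes only the
conditional finite-𝕋⁴ rung `BalabanLadder.UV`; `IR` stays OPEN behind the XL stubs `stub_purityChannel` (= the infrared wall,
re-typed, not lowered) and `stub_afPin`, and the residual `stub_residual`.  This file claims no registered stub of another line.
Card: `Cruxes/IR/Lines/harmonic-purity-channel.md`; crux idea `Cruxes/IR/Ideas/harmonic-purity-channel.md`.
-/

set_option autoImplicit false

noncomputable section

open Filter Topology MeasureTheory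
open scoped SchwartzMap
open Literature.MathematicalPhysics.QuantumFieldTheory Literature.MathematicalPhysics.QuantumLattice
open Summit.QuantumFields.YangMills.Cruxes.IR.ColdPressurePincer (AFToColdPressure IRnsc)
open Summit.QuantumFields.YangMills.Cruxes.IR.ColdPurityBridge (coldDefect ColdExitSC ColdDoublingRecursionSC IR_of_bridge)
open Summit.QuantumFields.YangMills.Cruxes.IR.AspectBootstrap (R_holds)

namespace Summit.QuantumFields.YangMills.Cruxes.IR.HarmonicPurityChannel

/-! ## §1 Currency: cold-torus partition functions with an arbitrary complex plaquette weight -/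

section Defs

variable {G : Type} [Group G] [TopologicalSpace G] [IsTopologicalGroup G] [CompactSpace G]
  [MeasurableSpace G] [BorelSpace G]

/-- The partition function of the `Fin`-indexed four-torus `n₀ × n₁ × n₂ × n₃` with an arbitrary complex plaquette weight
`w : G → ℂ` (product of normalised Haar measures over the positively oriented links):
`Z[w](n₀,n₁,n₂,n₃) = ∫ ∏_x ∏_{μ<ν} w(U_{x,μν}) ∏ dHaar`.  For `w = exp(−β (N − Re tr ρ ·))` it is `wilsonFinTorusPartition ρ β`
(`∏ exp = exp ∑`; part of `stub_exit_of_channel`). -/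
def weightFinTorusPartition (w : G → ℂ) (n₀ n₁ n₂ n₃ : ℕ) : ℂ :=
  ∫ U, ∏ x : FinTorusSite n₀ n₁ n₂ n₃, ∏ q : {q : Fin 4 × Fin 4 // q.1 < q.2},
      w (finTorusPlaquette U x q.1.1 q.1.2)
    ∂(Measure.pi fun _ : FinTorusSite n₀ n₁ n₂ n₃ × Fin 4 => haarProbability G)

/-- The complex **purity ratio** of the cold tori of side `L`: `h_L[w] = Z[w](L,L,L,2⌊L/4⌋) / Z[w](L,L,L,⌊L/4⌋)²`
(= `tr 𝒯^{2t} / (tr 𝒯^t)²` when a transfer operator exists; `1 − h_L` = the cold period-doubling defect `coldDefect` at a real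
Wilson weight).  Bulk free energies cancel exactly in it. -/
def purityRatio (w : G → ℂ) (L : ℕ) : ℂ :=
  weightFinTorusPartition w L L L (2 * (L / 4)) / weightFinTorusPartition w L L L (L / 4) ^ 2

/-- The Wilson plaquette weight of the representation `ρ` at COMPLEX coupling `z`: `g ↦ exp(−z (N − Re tr ρ(g)))`. -/
def wilsonWeightC {N : ℕ} (ρ : G →* Matrix (Fin N) (Fin N) ℂ) (z : ℂ) : G → ℂ :=
  fun g => Complex.exp (-(z * ((((N : ℝ) - (ρ g).trace.re) : ℝ) : ℂ)))

end Defs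

/-! ## §2 The statements of the line -/

/-- **LOAD `PurityChannel` (XL — the infrared wall in complex-analytic currency).**  For compact simple simply-connected `G`,
every faithful unitary lattice representation `r`, every anchor tolerance `ε > 0`, and every weak coupling `β ≥ β₁(G,r)`:
there is a HOLOMORPHIC CHANNEL — an open connected `D ⊂ ℂ`, a family of complex plaquette weights `w : D → (G → ℂ)`
holomorphic in `z` for each group element, continuous and uniformly bounded, `ε`-close to the Haar weight `1` on a closed
anchor disc `B̄(z₀,δ₀) ⊆ D`, equal to the Wilson weight of `r` at `β` at a target point `z_T ∈ D` — along which, for all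
`L ≥ L₀`, the cold partition function `Z[w_z](L³×⌊L/4⌋)` has NO zero and the purity ratio is bounded, `‖h_L[w_z]‖ ≤ M`.
(«No wall of cold-torus Fisher zeros / purity blow-ups separates strong from weak coupling.»)  Why it might fail: it is
false exactly where E is false — `U(1)₄` (zeros pinch the real axis at the Coulomb transition), `π₁(G) ≠ 1` (light flux makes
`h_L → 1/|π₁|³`-type impurity, so a blow-up/zero wall must cross every channel); for simple simply-connected `G` it is the
complex shadow of «no deconfining bulk transition», asserted nowhere. -/
def PurityChannel : Prop :=
  ∀ (G : Type) [Group G] [TopologicalSpace G] [IsTopologicalGroup G] [CompactSpace G],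
    IsCompactSimpleLieGroup G → SimplyConnectedSpace G →
    letI : MeasurableSpace G := borel G
    haveI : BorelSpace G := ⟨rfl⟩
    ∀ r : LatticeRep G, ∀ ε : ℝ, 0 < ε → ∃ β₁ : ℝ, ∀ β : ℝ, β₁ ≤ β →
      ∃ (D : Set ℂ) (w : ℂ → G → ℂ) (z₀ zT : ℂ) (δ₀ M B : ℝ) (L₀ : ℕ),
        IsOpen D ∧ IsConnected D ∧ 0 < δ₀ ∧ Metric.closedBall z₀ δ₀ ⊆ D ∧ zT ∈ D ∧
        (∀ g : G, DifferentiableOn ℂ (fun z => w z g) D) ∧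
        (∀ z ∈ D, Continuous (w z)) ∧
        (∀ z ∈ D, ∀ g : G, ‖w z g‖ ≤ B) ∧
        (∀ z ∈ Metric.closedBall z₀ δ₀, ∀ g : G, ‖w z g - 1‖ ≤ ε) ∧
        w zT = wilsonWeightC r.ρ (β : ℂ) ∧
        ∀ L : ℕ, L₀ ≤ L → ∀ z ∈ D,
          weightFinTorusPartition (w z) L L L (L / 4) ≠ 0 ∧ ‖purityRatio (w z) L‖ ≤ M

/-- **`ComplexAnchor` (L — located supplier: complex strong coupling).**  There are ABSOLUTE constants `ε₀, C, c > 0`, `L₀`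
such that for every compact metrisable group `G` and every continuous complex plaquette weight `w` with `‖w − 1‖∞ ≤ ε₀` the
cold partition function `Z[w](L³×⌊L/4⌋)` is non-zero and `‖1 − h_L[w]‖ ≤ C L⁴ e^{−cL}` for all `L ≥ L₀` (Kotecký–Preiss
polymer expansion of the plaquette gas with activity `w − 1`: bulk clusters cancel in the ratio, only clusters wrapping the
time circle of length `⌊L/4⌋` survive).  The complex-WILSON instance is in tree (`PeriodicBoxFreeEnergyLimits.exists_tube_rate`:
`‖log Z(N³×t)(z) − t e_N(z)‖ ≤ 12 N³ t e^{−⌊t/2⌋}`, `‖z‖ ≤ r_ρ`); the real instance is `coldDefect_le_of_strongCoupling`. -/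
def ComplexAnchor : Prop :=
  ∃ ε₀ C c : ℝ, 0 < ε₀ ∧ 0 < c ∧ ∃ L₀ : ℕ,
    ∀ (G : Type) [Group G] [TopologicalSpace G] [IsTopologicalGroup G] [CompactSpace G]
      [SecondCountableTopology G] [MeasurableSpace G] [BorelSpace G],
      ∀ w : G → ℂ, Continuous w → (∀ g : G, ‖w g - 1‖ ≤ ε₀) →
        ∀ L : ℕ, L₀ ≤ L →
          weightFinTorusPartition w L L L (L / 4) ≠ 0 ∧
          ‖1 - purityRatio w L‖ ≤ C * (L : ℝ) ^ 4 * Real.exp (-(c * (L : ℝ)))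

/-- **`TwoConstants` (M — classical complex analysis: Nevanlinna's two-constants theorem in the weak form «propagation of
smallness along a chain of Hadamard three-circles»).**  For an open connected `D ⊆ ℂ`, a closed disc `B̄(z₀,δ₀) ⊆ D` and a
point `z_T ∈ D` there is an exponent `ω ∈ (0,1]` — a lower bound for the harmonic measure of the disc seen from `z_T` —
such that EVERY `F` holomorphic on `D` with `‖F‖ ≤ A` on `D` and `‖F‖ ≤ a` on the disc (`0 < a ≤ A`) obeys
`‖F(z_T)‖ ≤ a^ω A^{1−ω}`.  (Mathlib: `Complex.HadamardThreeLines` after `z = c + e^{u}` gives three-circles; chain the discs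
along a compact path from `z₀` to `z_T`.) -/
def TwoConstants : Prop :=
  ∀ (D : Set ℂ), IsOpen D → IsConnected D →
    ∀ (z₀ : ℂ) (δ₀ : ℝ), 0 < δ₀ → Metric.closedBall z₀ δ₀ ⊆ D → ∀ zT : ℂ, zT ∈ D →
      ∃ ω : ℝ, 0 < ω ∧ ω ≤ 1 ∧
        ∀ F : ℂ → ℂ, DifferentiableOn ℂ F D →
          ∀ a A : ℝ, 0 < a → a ≤ A →
            (∀ z ∈ D, ‖F z‖ ≤ A) → (∀ z ∈ Metric.closedBall z₀ δ₀, ‖F z‖ ≤ a) →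
              ‖F zT‖ ≤ a ^ ω * A ^ (1 - ω)

/-! ## §3 Registered stubs (sorried; each a genuine lemma of the line) -/

/-- LOAD (XL, rank: hardest).  See `PurityChannel`. -/
theorem stub_purityChannel : PurityChannel := by
  sorry

/-- Located supplier (L): complex strong-coupling purity for a near-Haar plaquette activity.  See `ComplexAnchor`. -/
theorem stub_complexAnchor : ComplexAnchor := by
  sorry

/-- Classical (M): two-constants / propagation of smallness.  See `TwoConstants`. -/
theorem stub_twoConstants : TwoConstants := by
  sorry

/-- SEAM (M/L): channel ∧ anchor ∧ two-constants ⇒ E.  Per `(G, r)`: take `ε := ε₀` of the anchor, `β₁` of the channel;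
for `β ≥ β₁` the map `z ↦ 1 − h_L[w_z]` is holomorphic on `D` for `L ≥ L₀` (parametric Haar integrals of a bounded continuous
integrand holomorphic in `z`; denominator zero-free), bounded by `1 + M`, and `≤ C L⁴ e^{−cL}` on the anchor disc; at `z_T`,
`∏ exp = exp ∑` identifies `Z[w_{z_T}]` with `↑(wilsonFinTorusPartition r.ρ β …)`, so `1 − h_L(z_T) = ↑(coldDefect r.ρ β L)`;
`TwoConstants` gives `coldDefect r.ρ β L ≤ (C L⁴ e^{−cL})^ω (1+M)^{1−ω} → 0`, whence `ColdExitSC`. -/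
theorem stub_exit_of_channel : PurityChannel → ComplexAnchor → TwoConstants → ColdExitSC := by
  sorry

/-- X (XL, SHARED with lines af-pincer / doubling-bridge; not this line's content): the asymptotic-freedom pin. -/
theorem stub_afPin : AFToColdPressure := by
  sorry

/-- N (residual, SHARED): the non-simply-connected half of the crux, left open by name. -/
theorem stub_residual : IRnsc := by
  sorry

/-! ## §4 The line concludes the crux BY NAME (kernel-checked, no sorry) -/

/-- **`IR_of`**: the six stub STATEMENTS imply `BalabanLadder.IR` — `E` from (channel, anchor, two-constants) by the seam,
then the PROVED `ColdPurityBridge.IR_of_bridge` over the PROVED `AspectBootstrap.R_holds`. -/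
theorem IR_of (hZ : PurityChannel) (hA : ComplexAnchor) (hT : TwoConstants)
    (hseam : PurityChannel → ComplexAnchor → TwoConstants → ColdExitSC)
    (hX : AFToColdPressure) (hN : IRnsc) :
    Summit.QuantumFields.YangMills.Theses.BalabanLadder.IR :=
  IR_of_bridge R_holds (hseam hZ hA hT) hX hN

/-- The composition over the registered stubs (inherits their sorries; shows the wiring closes the crux by name). -/
theorem IR_of_stubs : Summit.QuantumFields.YangMills.Theses.BalabanLadder.IR :=
  IR_of stub_purityChannel stub_complexAnchor stub_twoConstants stub_exit_of_channel stub_afPin stub_residual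

end Summit.QuantumFields.YangMills.Cruxes.IR.HarmonicPurityChannel

end
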